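import Summits.HodgeConjecture.HodgeConjecture.Theorems.F0P3cStCharTSHCDGroupToLie              -- ★ (F0P3a-p06 g21) F-D6 §4 `exists_nhds_setLIntegral_theta_lt_top` (group ⟸ Lie); brings ★ `…HCDCayleyChartAt.isClosedEmbedding_subtype`
import Summits.HodgeConjecture.HodgeConjecture.Theorems.F0P3cStCharTSHCDLieGlobalFinal          -- ★ p852174 (F0P3a-p07 g19) GLOBAL-FINAL `forall_exists_nhds_setLIntegral_etaInv_lt_top_of_cusp`, `isClosed_traceZero`, `isClosed_coeffGroup`
import Summits.HodgeConjecture.HodgeConjecture.Theorems.F0P3cStCharTSHCDCoordinatesTraceZero   -- ★ (F0P2-p06 g18) (CO) `exists_coords_lie_traceZero` (the chart `Φ₀ : (Fin 8 → F′) ≃ₜ+ ↥𝔲₀`)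
import Summits.HodgeConjecture.HodgeConjecture.Theorems.F0P3cStCharTSTubeModelTransport        -- ★ p851879 (J6-T) `model_pins` (`σ_w` involutive ∕ isometric ∕ continuous, `J_w = Φ₃`); brings ★ `Gqs`, `qsForm`, `placeForm`
import Summits.HodgeConjecture.HodgeConjecture.Theorems.F0P3cStCharTSModelHaarPins             -- ★ p851908 (T5) `locallyCompactSpace_unitaryGroupOfForm`
import Summits.HodgeConjecture.HodgeConjecture.Theorems.F0P3cStCharTSHCDCuspDocking           -- ★ (F0P3b-p01 g19) (HC) `forall_exists_nhds_setLIntegral_cuspInv_lt_top` (the cusp leaf on `↥A`); brings ★ (NB)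
import Literature.NumberTheory.LocalFields.FiniteEmbeddingNormAbs                              -- ★ p852113 (LH10-p01 g7) (NB) `normAbs_map_eq_sq_of_involution`
import Literature.NumberTheory.Automorphic.QuadraticPlaceDescentPins                           -- ★ (F0P3a-p07 g19) (MP) model pins: `isClosedEmbedding_algebraMap_adicCompletion_place`, `galAdicCompletionMap_eq_self_iff_mem_range`, `exists_units_galAdicCompletionMap_eq_neg`, `setOf_galAdicCompletionMap_mul_self_eq_one_infinite`; brings the `Algebra (L⁺_v) (L_w)` instance
import Mathlib.MeasureTheory.Measure.Haar.Basic
import Summits.HodgeConjecture.HodgeConjecture.Theorems.F0P3cStCharTSHCDescentSemisimpleFinal   -- ★ p852250 (F0P3a-p05 g23) (ii) `forall_exists_nhds_setLIntegral_etaInv_lt_top_traceZero_of_isSplitSemisimple` (ED. 2)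
import Summits.HodgeConjecture.HodgeConjecture.Theorems.F0P3cStCharTSHCDSlodowySliceFinal        -- ★ p852300 (A-p12 g29) (iii) `exists_nhds_setLIntegral_etaInv_lt_top_of_sq_zero` (ED. 3); ★ D5(i) `…HCDRegularPoints` comes with ★ GLOBAL-FINAL
import HarnessLib

/-!
# F0 · P3c · line LH6 «StCharTS» — ROAD «HC-D» brick (MI) «MODEL INSTANTIATION»: `|D_G|^{−1∕2}` is locally `∫⁻`-finite on the one-place model `U(σ_w, Φ₃)(L_w)`
# — the road's DAG assembled at `K = L_w` (Harish-Chandra 1970 Part VII §1 Thm. 15, in-house for `U(3)`)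

Cell `pub/hodgecm-mathlib`, crux H413 = `stmt-HodgeConjecture-24833` (lane `--supports … --as helper`); seat LH6-p03 (g6); deal (MI) of the «HC-D» road holder F0P2-p01 (g23)
(F0∕P2 bus 2026-09-02T16:54:56Z).  THEOREMS ONLY; no definition ∕ instance ∕ notation ∕ named fact ∕ `sorry`; ★-only imports.  HONEST LABEL: count-neutral; pays no organ by
itself — it is the MODEL binder of ★ p852121 `…WeylDiscrLocInt.locallyIntegrable_weylDiscr_inv_of_forall_model` (D7-FINAL, one `exact`), i.e. the named input `hDGliO` of ★ RUNG0.
HC_CM is proved only modulo the 7 printed citations (2 remaining: hLiu418 = `stmt-HodgeConjecture-24832`, h413 = `stmt-HodgeConjecture-24833`) until rung 0 closes.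

WHAT.  At `K := L_w` (`w` the place above a NON-SPLIT `v`, `hw : c • w = w`), `σ := σ_w = galAdicCompletionMap c hw`, `J := J_w = placeForm Φ₃ w = !![0,0,1;0,1,0;1,0,0]`,
`U′ := U(σ_w, J_w)(L_w)`, `F′ := L⁺_v`, `ι := algebraMap F′ L_w`, the road's two generic heads compose:
* ★ GLOBAL-FINAL `…_of_cusp` (F0P3a-p07): `ηι = (↑√√|discr χ_X|)⁻¹` is locally `∫⁻`-finite at every `X ∈ ↥𝔲` GIVEN the three analytic leaves (HC) `hcusp` (cusp integrand on the
  coefficient group `↥A`), (iii) `hsq` (non-zero square-zero points of `↥𝔲₀`), (ii) `hss` (split semisimple non-scalar points of `↥𝔲₀`) and the coordinate letters (NB) `hιn`, (CO) `Φ₀`;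
* ★ F-D6 §4 `exists_nhds_setLIntegral_theta_lt_top` (F0P3a-p06): group ⟸ Lie for any `ρ : G →* GL₃(K)` inducing injective onto `U(σ, J)`, given infinitely many norm-one scalars.
THIS FILE discharges the MODEL LETTERS — (m1) `σ_w` pins (★ `model_pins`), `J_w = !![0,0,1;0,1,0;1,0,0]`, `(J_w.map σ_w)ᵀ = J_w`, `IsUnit J_w.det`; (m5) `2, 3 ≠ 0`; (m6) the carriers
`𝔲 = ker (X ↦ ᵗ(σX)J + JX)`, `𝔲₀ = 𝔲 ⊓ ker trace`, `A = ker ((c, d) ↦ (σc − c, σd + d))` with Borel σ-algebras, local compactness (closed in `M₃(K)` ∕ `K × K`) and Mathlib's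
`addHaar`; (m7) `hιn` := ★ (NB), `Φ₀` := ★ (CO); the group data `G := ↥U′`, `ρ := U′.subtype` (inducing, injective, range = unitary by `Iff.rfl`), `U′` locally compact (★ T5) and
second countable; the four (MP) pins «`ι` closed embedding, `Fix(σ_w) = range ι`, a skew unit, norm-one scalars infinite» (★ F0P3a-p07 `QuadraticPlaceDescentPins`) and the cusp leaf
(HC) (★ F0P3b-p01 `…HCDCuspDocking`) are consumed BY NAME — and states the head with the TWO remaining analytic leaves (iii) `hsq`, (ii) `hss` as HYPOTHESES in ★ GLOBAL-FINAL's
letters (universally quantified over the carrier presentation `(𝔲₀, h𝔲₀)` and its Haar measure, so the suppliers' heads dock by `fun 𝔲₀ h𝔲₀ _ _ μ₀ _ => head …`).  When they land, an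
append-only edition adds the hypothesis-free `hcd_model` = the MODEL binder of ★ p852121 D7-FINAL.

## References
* [HarishChandra1970] Harish-Chandra (notes by G. van Dijk), *Harmonic analysis on reductive p-adic groups*, LNM 162 (1970), Part VII §1 Thm. 15.
* [Rogawski1990] J. D. Rogawski, *Automorphic Representations of Unitary Groups in Three Variables*, Ann. of Math. Stud. 123 (1990), §4.9 p. 54; §12.5 p. 182.
* [PlatonovRapinchuk1994] V. Platonov, A. Rapinchuk, *Algebraic Groups and Number Theory* (1994), §3.3, §5.1.
-/

set_option autoImplicit false
-- the mandated namespace has the single-problem summit's repeated segment (`HodgeConjecture.HodgeConjecture`)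
set_option linter.dupNamespace false

noncomputable section

open Set Filter MeasureTheory MeasureTheory.Measure TopologicalSpace Topology Matrix
open NumberField IsDedekindDomain
open Literature.NumberTheory Literature.NumberTheory.Automorphic Literature.NumberTheory.Automorphic.UnitaryGroup Literature.NumberTheory.Rogawski1990
open Literature.NumberTheory.GaloisRepresentations Literature.NumberTheory.LocalFields
open Summit.HodgeConjecture.HodgeConjecture.Cruxes.H413
open Summit.HodgeConjecture.HodgeConjecture.Cruxes.H413.F0P3cStCharTSHCDCayleyChartAt
open Summit.HodgeConjecture.HodgeConjecture.Cruxes.H413.F0P3cStCharTSHCDGroupToLie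
open Summit.HodgeConjecture.HodgeConjecture.Cruxes.H413.F0P3cStCharTSHCDLieGlobalFinal
open Summit.HodgeConjecture.HodgeConjecture.Cruxes.H413.F0P3cStCharTSHCDCoordinates
open Summit.HodgeConjecture.HodgeConjecture.Cruxes.H413.F0P3cStCharTSTubeModelTransport
open Summit.HodgeConjecture.HodgeConjecture.Cruxes.H413.F0P3cStCharTSModelHaarPins
open Summit.HodgeConjecture.HodgeConjecture.Cruxes.H413.F0P3cStCharTSHCDCuspDocking
open Summit.HodgeConjecture.HodgeConjecture.Cruxes.H413.F0P3cStCharTSHCDescentSemisimpleFinal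
open Summit.HodgeConjecture.HodgeConjecture.Cruxes.H413.F0P3cStCharTSHCDSlodowySliceFinal
open Summit.HodgeConjecture.HodgeConjecture.Cruxes.H413.F0P3cStCharTSHCDRegularPoints
open scoped ENNReal NNReal MatrixGroups

namespace Summit.HodgeConjecture.HodgeConjecture.Cruxes.H413.F0P3cStCharTSHCDModel

/-! ## §1 Generic letters: second countability of `GL₃`, the carriers as kernels -/

section Generic

variable {K : Type*} [Field K] [ValuativeRel K] [TopologicalSpace K] [IsNonarchimedeanLocalField K]

/-- `GL₃(K)` is second countable (`K` is; `GL₃ ↪ M₃ × M₃ᵐᵒᵖ`). [folklore] -/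
theorem secondCountableTopology_GL_fin_three : SecondCountableTopology (GL (Fin 3) K) := by
  haveI : SecondCountableTopology K := secondCountableTopology_localField K
  haveI : SecondCountableTopology (Matrix (Fin 3) (Fin 3) K) := inferInstanceAs (SecondCountableTopology (Fin 3 → Fin 3 → K))
  haveI : SecondCountableTopology (Matrix (Fin 3) (Fin 3) K)ᵐᵒᵖ := MulOpposite.opHomeomorph.symm.secondCountableTopology
  exact Units.isEmbedding_embedProduct.secondCountableTopology

omit [ValuativeRel K] [TopologicalSpace K] [IsNonarchimedeanLocalField K] in
/-- **The unitary Lie algebra as a kernel**: there is an additive subgroup `𝔲 ≤ M₃(K)` with `X ∈ 𝔲 ↔ ᵗ(σX)·J + J·X = 0` (the kernel of the additive map `X ↦ ᵗ(σX)J + JX`).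
[cite: PlatonovRapinchuk1994, §3.3] -/
theorem exists_lieCarrier (σ : K →+* K) (J : Matrix (Fin 3) (Fin 3) K) :
    ∃ 𝔲 : AddSubgroup (Matrix (Fin 3) (Fin 3) K), ∀ X, X ∈ 𝔲 ↔ (X.map σ)ᵀ * J + J * X = 0 := by
  refine ⟨AddMonoidHom.ker (AddMonoidHom.mk' (fun X : Matrix (Fin 3) (Fin 3) K => (X.map σ)ᵀ * J + J * X) fun X Y => ?_), fun X => ?_⟩
  · rw [Matrix.map_add _ (map_add σ), Matrix.transpose_add, Matrix.add_mul, Matrix.mul_add]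
    abel
  · rw [AddMonoidHom.mem_ker]; rfl

omit [ValuativeRel K] [TopologicalSpace K] [IsNonarchimedeanLocalField K] in
/-- **Its trace-zero part as a kernel**: `X ∈ 𝔲₀ ↔ ᵗ(σX)·J + J·X = 0 ∧ trace X = 0`. [cite: PlatonovRapinchuk1994, §3.3] -/
theorem exists_lieCarrier_traceZero (σ : K →+* K) (J : Matrix (Fin 3) (Fin 3) K) :
    ∃ 𝔲₀ : AddSubgroup (Matrix (Fin 3) (Fin 3) K), ∀ X, X ∈ 𝔲₀ ↔ (X.map σ)ᵀ * J + J * X = 0 ∧ Matrix.trace X = 0 := by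
  obtain ⟨𝔲, h𝔲⟩ := exists_lieCarrier σ J
  refine ⟨𝔲 ⊓ AddMonoidHom.ker (Matrix.traceAddMonoidHom (Fin 3) K), fun X => ?_⟩
  rw [AddSubgroup.mem_inf, h𝔲, AddMonoidHom.mem_ker]
  rfl

omit [ValuativeRel K] [TopologicalSpace K] [IsNonarchimedeanLocalField K] in
/-- **The cusp coefficient group as a kernel**: `(c, d) ∈ A ↔ σ c = c ∧ σ d = −d`. [cite: PlatonovRapinchuk1994, §3.3] -/
theorem exists_coeffCarrier (σ : K →+* K) :
    ∃ A : AddSubgroup (K × K), ∀ p : K × K, p ∈ A ↔ σ p.1 = p.1 ∧ σ p.2 = -p.2 := by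
  refine ⟨AddMonoidHom.ker (AddMonoidHom.mk' (fun p : K × K => (σ p.1 - p.1, σ p.2 + p.2)) fun p q => ?_), fun p => ?_⟩
  · ext <;> simp only [Prod.fst_add, Prod.snd_add, map_add, Prod.mk_add_mk] <;> ring
  · rw [AddMonoidHom.mem_ker, AddMonoidHom.mk'_apply, Prod.mk_eq_zero, sub_eq_zero, add_eq_zero_iff_eq_neg]

end Generic

/-! ## §2 The model letters of `U(σ_w, Φ₃)(L_w)` -/

section CM

variable (L : Type) [Field L] [NumberField L] [IsCMField L] (v : HeightOneSpectrum (𝓞 ↥(maximalRealSubfield L)))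
  (w : PlacesOver L v) (hw : IsCMField.complexConj L • w.1 = w.1)

omit [IsCMField L] in
/-- **`J_w = !![0,0,1;0,1,0;1,0,0]`**: the split form `Φ₃` read in `L_w`. [cite: Rogawski1990, §1.9 p. 8] [cite: PlatonovRapinchuk1994, §5.1] -/
theorem placeForm_qsForm_eq : placeForm (Rogawski1990.qsForm L) w.1 = !![0, 0, 1; 0, 1, 0; 1, 0, 0] := by
  ext i j
  fin_cases i <;> fin_cases j <;> simp [placeForm, Rogawski1990.qsForm]

/-- **`J_w` is `σ_w`-hermitian**: `(J_w.map σ_w)ᵀ = J_w` (entries `0, 1`). [cite: Rogawski1990, §1.9 p. 8] -/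
theorem map_transpose_placeForm_qsForm :
    ((placeForm (Rogawski1990.qsForm L) w.1).map (galAdicCompletionMap (L := L) (IsCMField.complexConj L) hw))ᵀ = placeForm (Rogawski1990.qsForm L) w.1 := by
  rw [placeForm_qsForm_eq]
  ext i j
  fin_cases i <;> fin_cases j <;> simp

omit [IsCMField L] in
/-- **`det J_w` is a unit** (`det Φ₃ = −1`). [cite: Rogawski1990, §1.9 p. 8] -/
theorem isUnit_det_placeForm_qsForm : IsUnit (placeForm (Rogawski1990.qsForm L) w.1).det := by
  rw [placeForm_qsForm_eq, Matrix.det_fin_three]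
  simp

/-- **The range of `U′ ↪ GL₃(L_w)` is the unitary group** (`Iff.rfl` on ★ `unitaryGroupOfForm`). [cite: Rogawski1990, §1.9 p. 8] -/
theorem mem_range_subtype_iff (g : GL (Fin 3) (w.1.adicCompletion L)) :
    g ∈ Set.range ((unitaryGroupOfForm (galAdicCompletionMap (L := L) (IsCMField.complexConj L) hw) (placeForm (Rogawski1990.qsForm L) w.1)).subtype) ↔
      (((g : Matrix (Fin 3) (Fin 3) (w.1.adicCompletion L))).map (galAdicCompletionMap (L := L) (IsCMField.complexConj L) hw))ᵀ *
          placeForm (Rogawski1990.qsForm L) w.1 * (g : Matrix (Fin 3) (Fin 3) (w.1.adicCompletion L)) = placeForm (Rogawski1990.qsForm L) w.1 := by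
  rw [Subgroup.coe_subtype, Subtype.range_coe_subtype]
  exact Iff.rfl

/-! ## §3 HEAD (MI): `θ` is locally `∫⁻`-finite on `U(σ_w, Φ₃)(L_w)`, modulo the two analytic leaves (iii) `hsq` and (ii) `hss` -/

set_option maxHeartbeats 1600000 in
-- long binder lists instantiated at the model (class of ★ F-D6 §4 + ★ GLOBAL-FINAL)
/-- **(MI) «MODEL INSTANTIATION» — `|D_G|^{−1∕2}` IS LOCALLY `∫⁻`-FINITE ON `U(σ_w, Φ₃)(L_w)`** (the MODEL binder of ★ p852121 D7-FINAL) MODULO the two analytic leaves of road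
«HC-D» still in flight, stated in ★ GLOBAL-FINAL's letters at `K = L_w` and universally quantified over the carrier presentation and its Haar measure: `hsq` (D5(iii), A-p12: non-zero
square-zero points of `↥𝔲₀`) and `hss` (D5(ii), F0P3a-p05: split semisimple non-scalar points).  Everything else is discharged here BY NAME: ★ `model_pins` + §2 (the form), (m5)
`CharZero`, §1 carriers with `borel` ∕ Mathlib `addHaar` on the closed (locally compact) subtypes, ★ (MP) `QuadraticPlaceDescentPins` (closed embedding `ι`, `Fix(σ_w) = range ι`, skew
unit, norm-one scalars infinite), ★ (HC) `forall_exists_nhds_setLIntegral_cuspInv_lt_top`, ★ (NB), ★ (CO), ★ GLOBAL-FINAL, ★ T5, ★ F-D6 §4 at `G := ↥U′`, `ρ := U′.subtype`.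
[cite: HarishChandra1970, Part VII §1 Thm. 15] [cite: Rogawski1990, §4.9 p. 54; §12.5 p. 182] [cite: PlatonovRapinchuk1994, §3.3; §5.1] -/
theorem exists_nhds_setLIntegral_theta_lt_top_model
    (hsq : ∀ (𝔲₀ : AddSubgroup (Matrix (Fin 3) (Fin 3) (w.1.adicCompletion L)))
      (_ : ∀ X, X ∈ 𝔲₀ ↔ (X.map (galAdicCompletionMap (L := L) (IsCMField.complexConj L) hw))ᵀ * placeForm (Rogawski1990.qsForm L) w.1 +
        placeForm (Rogawski1990.qsForm L) w.1 * X = 0 ∧ Matrix.trace X = 0)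
      [MeasurableSpace ↥𝔲₀] [BorelSpace ↥𝔲₀] (μ₀ : Measure ↥𝔲₀) [μ₀.IsAddHaarMeasure],
      ∀ X₀ : ↥𝔲₀, X₀ ≠ 0 → (X₀ : Matrix (Fin 3) (Fin 3) (w.1.adicCompletion L)) * (X₀ : Matrix (Fin 3) (Fin 3) (w.1.adicCompletion L)) = 0 →
        ∃ U ∈ 𝓝 X₀, ∫⁻ X in U, ((NNReal.sqrt (NNReal.sqrt (IsNonarchimedeanLocalField.normAbs (w.1.adicCompletion L)
          (Matrix.charpoly (X : Matrix (Fin 3) (Fin 3) (w.1.adicCompletion L))).discr)) : ℝ≥0∞))⁻¹ ∂μ₀ < ∞)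
    (hss : ∀ (𝔲₀ : AddSubgroup (Matrix (Fin 3) (Fin 3) (w.1.adicCompletion L)))
      (_ : ∀ X, X ∈ 𝔲₀ ↔ (X.map (galAdicCompletionMap (L := L) (IsCMField.complexConj L) hw))ᵀ * placeForm (Rogawski1990.qsForm L) w.1 +
        placeForm (Rogawski1990.qsForm L) w.1 * X = 0 ∧ Matrix.trace X = 0)
      [MeasurableSpace ↥𝔲₀] [BorelSpace ↥𝔲₀] (μ₀ : Measure ↥𝔲₀) [μ₀.IsAddHaarMeasure],
      ∀ X₀ : ↥𝔲₀, (∃ a b : w.1.adicCompletion L, a ≠ b ∧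
          ((X₀ : Matrix (Fin 3) (Fin 3) (w.1.adicCompletion L)) - a • (1 : Matrix (Fin 3) (Fin 3) (w.1.adicCompletion L))) *
            ((X₀ : Matrix (Fin 3) (Fin 3) (w.1.adicCompletion L)) - b • 1) = 0 ∧
          ∀ c : w.1.adicCompletion L, (X₀ : Matrix (Fin 3) (Fin 3) (w.1.adicCompletion L)) ≠ c • 1) →
        ∃ U ∈ 𝓝 X₀, ∫⁻ X in U, ((NNReal.sqrt (NNReal.sqrt (IsNonarchimedeanLocalField.normAbs (w.1.adicCompletion L)
          (Matrix.charpoly (X : Matrix (Fin 3) (Fin 3) (w.1.adicCompletion L))).discr)) : ℝ≥0∞))⁻¹ ∂μ₀ < ∞)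
    [MeasurableSpace ↥(unitaryGroupOfForm (galAdicCompletionMap (L := L) (IsCMField.complexConj L) hw) (placeForm (Rogawski1990.qsForm L) w.1))]
    [BorelSpace ↥(unitaryGroupOfForm (galAdicCompletionMap (L := L) (IsCMField.complexConj L) hw) (placeForm (Rogawski1990.qsForm L) w.1))]
    (ν' : Measure ↥(unitaryGroupOfForm (galAdicCompletionMap (L := L) (IsCMField.complexConj L) hw) (placeForm (Rogawski1990.qsForm L) w.1))) [ν'.IsHaarMeasure]
    (g₀ : ↥(unitaryGroupOfForm (galAdicCompletionMap (L := L) (IsCMField.complexConj L) hw) (placeForm (Rogawski1990.qsForm L) w.1))) :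
    ∃ U ∈ 𝓝 g₀, ∫⁻ g in U,
      ((NNReal.sqrt (NNReal.sqrt (IsNonarchimedeanLocalField.normAbs (w.1.adicCompletion L)
          (((g : ↥(unitaryGroupOfForm (galAdicCompletionMap (L := L) (IsCMField.complexConj L) hw) (placeForm (Rogawski1990.qsForm L) w.1))) :
              GL (Fin 3) (w.1.adicCompletion L)) : Matrix (Fin 3) (Fin 3) (w.1.adicCompletion L)).charpoly.discr *
        ((IsNonarchimedeanLocalField.normAbs (w.1.adicCompletion L)
          (((g : ↥(unitaryGroupOfForm (galAdicCompletionMap (L := L) (IsCMField.complexConj L) hw) (placeForm (Rogawski1990.qsForm L) w.1))) :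
              GL (Fin 3) (w.1.adicCompletion L)) : Matrix (Fin 3) (Fin 3) (w.1.adicCompletion L)).det) ^ 2)⁻¹)) : ℝ≥0) : ℝ≥0∞)⁻¹ ∂ν' < ∞ := by
  classical
  -- (m1) the pins of the one-place model
  obtain ⟨hσσ, -, hσc, -⟩ := model_pins L v w hw
  -- the (MP) pins of the place `w` (★ F0P3a-p07)
  have hι := isClosedEmbedding_algebraMap_adicCompletion_place (IsCMField.complexConj L) (IsCMField.complexConj_ne_one L) v w hw
  have hιr : ∀ x : w.1.adicCompletion L, galAdicCompletionMap (L := L) (IsCMField.complexConj L) hw x = x ↔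
      x ∈ Set.range (algebraMap (v.adicCompletion ↥(maximalRealSubfield L)) (w.1.adicCompletion L)) :=
    fun x => galAdicCompletionMap_eq_self_iff_mem_range (IsCMField.complexConj L) (IsCMField.complexConj_ne_one L) v w hw x
  obtain ⟨lam, hlam⟩ := exists_units_galAdicCompletionMap_eq_neg (IsCMField.complexConj L) (IsCMField.complexConj_ne_one L) v w hw
  have hE := setOf_galAdicCompletionMap_mul_self_eq_one_infinite (IsCMField.complexConj L) (IsCMField.complexConj_ne_one L) v w hw
  have hJσ := map_transpose_placeForm_qsForm L v w hw
  have hJd := isUnit_det_placeForm_qsForm L v w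
  have hJ' := placeForm_qsForm_eq L v w
  -- (m5) characteristic zero
  haveI : CharZero (w.1.adicCompletion L) := charZero_of_injective_algebraMap (algebraMap (L : Type) (w.1.adicCompletion L)).injective
  have h2 : (2 : w.1.adicCompletion L) ≠ 0 := two_ne_zero
  have h3 : (3 : w.1.adicCompletion L) ≠ 0 := three_ne_zero
  letI : Invertible (2 : w.1.adicCompletion L) := invertibleOfNonzero h2
  -- topology of `K = L_w` and `M₃(K)`
  haveI : T2Space (w.1.adicCompletion L) := (IsNonarchimedeanLocalField.isLocalField (w.1.adicCompletion L)).toT2Space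
  haveI : LocallyCompactSpace (Matrix (Fin 3) (Fin 3) (w.1.adicCompletion L)) :=
    inferInstanceAs (LocallyCompactSpace (Fin 3 → Fin 3 → w.1.adicCompletion L))
  -- (m6) the carriers, Borel σ-algebras, local compactness, Haar measures
  obtain ⟨𝔲, h𝔲⟩ := exists_lieCarrier (galAdicCompletionMap (L := L) (IsCMField.complexConj L) hw) (placeForm (Rogawski1990.qsForm L) w.1)
  obtain ⟨𝔲₀, h𝔲₀⟩ := exists_lieCarrier_traceZero (galAdicCompletionMap (L := L) (IsCMField.complexConj L) hw) (placeForm (Rogawski1990.qsForm L) w.1)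
  obtain ⟨A, hA⟩ := exists_coeffCarrier (galAdicCompletionMap (L := L) (IsCMField.complexConj L) hw)
  letI : MeasurableSpace ↥𝔲 := borel _
  haveI : BorelSpace ↥𝔲 := ⟨rfl⟩
  letI : MeasurableSpace ↥𝔲₀ := borel _
  haveI : BorelSpace ↥𝔲₀ := ⟨rfl⟩
  letI : MeasurableSpace ↥A := borel _
  haveI : BorelSpace ↥A := ⟨rfl⟩
  haveI : LocallyCompactSpace ↥𝔲 :=
    (isClosedEmbedding_subtype (galAdicCompletionMap (L := L) (IsCMField.complexConj L) hw) (placeForm (Rogawski1990.qsForm L) w.1) 𝔲 hσc h𝔲).locallyCompactSpace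
  haveI : LocallyCompactSpace ↥𝔲₀ :=
    (isClosed_traceZero hσc (placeForm (Rogawski1990.qsForm L) w.1) 𝔲₀ h𝔲₀).isClosedEmbedding_subtypeVal.locallyCompactSpace
  haveI : LocallyCompactSpace ↥A := (isClosed_coeffGroup hσc A hA).isClosedEmbedding_subtypeVal.locallyCompactSpace
  -- (m7) the coordinate letters: ★ (NB) and ★ (CO)
  have hιn := fun x => normAbs_map_eq_sq_of_involution (algebraMap (v.adicCompletion ↥(maximalRealSubfield L)) (w.1.adicCompletion L)) hι.continuous
    (galAdicCompletionMap (L := L) (IsCMField.complexConj L) hw) hσσ hιr lam hlam x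
  obtain ⟨Φ₀, -, hΦ₀⟩ := exists_coords_lie_traceZero (galAdicCompletionMap (L := L) (IsCMField.complexConj L) hw) hσσ hJ'
    (algebraMap (v.adicCompletion ↥(maximalRealSubfield L)) (w.1.adicCompletion L)) hι hιr lam hlam 𝔲₀ h𝔲₀
  -- the Lie-algebra statement: ★ GLOBAL-FINAL
  have hLie := forall_exists_nhds_setLIntegral_etaInv_lt_top_of_cusp (galAdicCompletionMap (L := L) (IsCMField.complexConj L) hw) hσσ hσc hJσ hJd h2 h3
    lam hlam 𝔲 h𝔲 𝔲₀ h𝔲₀ (addHaar : Measure ↥𝔲₀) (addHaar : Measure ↥𝔲) A hA (addHaar : Measure ↥A) (forall_exists_nhds_setLIntegral_cuspInv_lt_top (galAdicCompletionMap (L := L) (IsCMField.complexConj L) hw) hσσ h2 h3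
      (algebraMap (v.adicCompletion ↥(maximalRealSubfield L)) (w.1.adicCompletion L)) hι hιr lam hlam A hA (addHaar : Measure ↥A))
    (algebraMap (v.adicCompletion ↥(maximalRealSubfield L)) (w.1.adicCompletion L)) hιn Φ₀ hΦ₀ (hsq 𝔲₀ h𝔲₀ addHaar) (hss 𝔲₀ h𝔲₀ addHaar)
  -- the group: `G := ↥U′`, `ρ := U′.subtype`; ★ T5 local compactness, second countability from `GL₃(K)`; ★ F-D6 §4
  haveI := locallyCompactSpace_unitaryGroupOfForm (galAdicCompletionMap (L := L) (IsCMField.complexConj L) hw) (placeForm (Rogawski1990.qsForm L) w.1) hσc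
  haveI : SecondCountableTopology (GL (Fin 3) (w.1.adicCompletion L)) := secondCountableTopology_GL_fin_three
  haveI : SecondCountableTopology ↥(unitaryGroupOfForm (galAdicCompletionMap (L := L) (IsCMField.complexConj L) hw) (placeForm (Rogawski1990.qsForm L) w.1)) :=
    TopologicalSpace.Subtype.secondCountableTopology _
  exact exists_nhds_setLIntegral_theta_lt_top (galAdicCompletionMap (L := L) (IsCMField.complexConj L) hw) (placeForm (Rogawski1990.qsForm L) w.1) 𝔲
    (addHaar : Measure ↥𝔲) ((unitaryGroupOfForm (galAdicCompletionMap (L := L) (IsCMField.complexConj L) hw) (placeForm (Rogawski1990.qsForm L) w.1)).subtype) ν'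
    hσc h2 hJd h𝔲 IsInducing.subtypeVal Subtype.val_injective (mem_range_subtype_iff L v w hw) hE hLie g₀

/-! ## §4 ED. 2 — the (ii) leaf DISCHARGED (★ F0P3a-p05 `…HCDescentSemisimpleFinal`): one hypothesis left -/

/-- **The (ii) leaf `hss` at the model, for EVERY presentation of the trace-zero carrier and EVERY Haar measure on it** (★ F0P3a-p05
`forall_exists_nhds_setLIntegral_etaInv_lt_top_traceZero_of_isSplitSemisimple`, fed with the model letters of §2 ∕ §3: ★ `model_pins`, the form, `CharZero`, the companion
carrier `𝔲` with `addHaar`, ★ (MP) pins, ★ (NB)). [cite: HarishChandra1970, Part VII §1 Thm. 15; Part VI Lemma 22] [cite: Rogawski1990, §3.6 pp. 28–31] -/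
theorem hss_model : ∀ (𝔲₀ : AddSubgroup (Matrix (Fin 3) (Fin 3) (w.1.adicCompletion L)))
      (_ : ∀ X, X ∈ 𝔲₀ ↔ (X.map (galAdicCompletionMap (L := L) (IsCMField.complexConj L) hw))ᵀ * placeForm (Rogawski1990.qsForm L) w.1 +
        placeForm (Rogawski1990.qsForm L) w.1 * X = 0 ∧ Matrix.trace X = 0)
      [MeasurableSpace ↥𝔲₀] [BorelSpace ↥𝔲₀] (μ₀ : Measure ↥𝔲₀) [μ₀.IsAddHaarMeasure],
      ∀ X₀ : ↥𝔲₀, (∃ a b : w.1.adicCompletion L, a ≠ b ∧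
          ((X₀ : Matrix (Fin 3) (Fin 3) (w.1.adicCompletion L)) - a • (1 : Matrix (Fin 3) (Fin 3) (w.1.adicCompletion L))) *
            ((X₀ : Matrix (Fin 3) (Fin 3) (w.1.adicCompletion L)) - b • 1) = 0 ∧
          ∀ c : w.1.adicCompletion L, (X₀ : Matrix (Fin 3) (Fin 3) (w.1.adicCompletion L)) ≠ c • 1) →
        ∃ U ∈ 𝓝 X₀, ∫⁻ X in U, ((NNReal.sqrt (NNReal.sqrt (IsNonarchimedeanLocalField.normAbs (w.1.adicCompletion L)
          (Matrix.charpoly (X : Matrix (Fin 3) (Fin 3) (w.1.adicCompletion L))).discr)) : ℝ≥0∞))⁻¹ ∂μ₀ < ∞ := by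
  classical
  intro 𝔲₀ h𝔲₀ _ _ μ₀ _
  obtain ⟨hσσ, -, hσc, -⟩ := model_pins L v w hw
  have hι := isClosedEmbedding_algebraMap_adicCompletion_place (IsCMField.complexConj L) (IsCMField.complexConj_ne_one L) v w hw
  have hιr : ∀ x : w.1.adicCompletion L, galAdicCompletionMap (L := L) (IsCMField.complexConj L) hw x = x ↔
      x ∈ Set.range (algebraMap (v.adicCompletion ↥(maximalRealSubfield L)) (w.1.adicCompletion L)) :=
    fun x => galAdicCompletionMap_eq_self_iff_mem_range (IsCMField.complexConj L) (IsCMField.complexConj_ne_one L) v w hw x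
  obtain ⟨lam, hlam⟩ := exists_units_galAdicCompletionMap_eq_neg (IsCMField.complexConj L) (IsCMField.complexConj_ne_one L) v w hw
  have hJσ := map_transpose_placeForm_qsForm L v w hw
  have hJd := isUnit_det_placeForm_qsForm L v w
  haveI : CharZero (w.1.adicCompletion L) := charZero_of_injective_algebraMap (algebraMap (L : Type) (w.1.adicCompletion L)).injective
  have h2 : (2 : w.1.adicCompletion L) ≠ 0 := two_ne_zero
  have h3 : (3 : w.1.adicCompletion L) ≠ 0 := three_ne_zero
  letI : Invertible (2 : w.1.adicCompletion L) := invertibleOfNonzero h2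
  haveI : T2Space (w.1.adicCompletion L) := (IsNonarchimedeanLocalField.isLocalField (w.1.adicCompletion L)).toT2Space
  haveI : LocallyCompactSpace (Matrix (Fin 3) (Fin 3) (w.1.adicCompletion L)) :=
    inferInstanceAs (LocallyCompactSpace (Fin 3 → Fin 3 → w.1.adicCompletion L))
  -- the companion carrier `𝔲` with Borel σ-algebra and `addHaar`
  obtain ⟨𝔲, h𝔲⟩ := exists_lieCarrier (galAdicCompletionMap (L := L) (IsCMField.complexConj L) hw) (placeForm (Rogawski1990.qsForm L) w.1)
  letI : MeasurableSpace ↥𝔲 := borel _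
  haveI : BorelSpace ↥𝔲 := ⟨rfl⟩
  haveI : LocallyCompactSpace ↥𝔲 :=
    (isClosedEmbedding_subtype (galAdicCompletionMap (L := L) (IsCMField.complexConj L) hw) (placeForm (Rogawski1990.qsForm L) w.1) 𝔲 hσc h𝔲).locallyCompactSpace
  have hιn := fun x => normAbs_map_eq_sq_of_involution (algebraMap (v.adicCompletion ↥(maximalRealSubfield L)) (w.1.adicCompletion L)) hι.continuous
    (galAdicCompletionMap (L := L) (IsCMField.complexConj L) hw) hσσ hιr lam hlam x
  exact forall_exists_nhds_setLIntegral_etaInv_lt_top_traceZero_of_isSplitSemisimple (galAdicCompletionMap (L := L) (IsCMField.complexConj L) hw) hσσ hσc hJσ hJd h2 h3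
    lam hlam 𝔲 h𝔲 𝔲₀ h𝔲₀ μ₀ (addHaar : Measure ↥𝔲) (algebraMap (v.adicCompletion ↥(maximalRealSubfield L)) (w.1.adicCompletion L)) hι hιr hιn

set_option maxHeartbeats 1600000 in
-- as §3
/-- **(MI) ED. 2 — `θ` locally `∫⁻`-finite on `U(σ_w, Φ₃)(L_w)` MODULO THE LAST LEAF (iii) `hsq`** (D5(iii), A-p12: non-zero square-zero points of `↥𝔲₀`, in ★ GLOBAL-FINAL's letters
∀ `(𝔲₀, h𝔲₀, μ₀)`): §3 with `hss := hss_model`. [cite: HarishChandra1970, Part VII §1 Thm. 15] [cite: Rogawski1990, §4.9 p. 54; §12.5 p. 182] -/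
theorem exists_nhds_setLIntegral_theta_lt_top_model₂
    (hsq : ∀ (𝔲₀ : AddSubgroup (Matrix (Fin 3) (Fin 3) (w.1.adicCompletion L)))
      (_ : ∀ X, X ∈ 𝔲₀ ↔ (X.map (galAdicCompletionMap (L := L) (IsCMField.complexConj L) hw))ᵀ * placeForm (Rogawski1990.qsForm L) w.1 +
        placeForm (Rogawski1990.qsForm L) w.1 * X = 0 ∧ Matrix.trace X = 0)
      [MeasurableSpace ↥𝔲₀] [BorelSpace ↥𝔲₀] (μ₀ : Measure ↥𝔲₀) [μ₀.IsAddHaarMeasure],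
      ∀ X₀ : ↥𝔲₀, X₀ ≠ 0 → (X₀ : Matrix (Fin 3) (Fin 3) (w.1.adicCompletion L)) * (X₀ : Matrix (Fin 3) (Fin 3) (w.1.adicCompletion L)) = 0 →
        ∃ U ∈ 𝓝 X₀, ∫⁻ X in U, ((NNReal.sqrt (NNReal.sqrt (IsNonarchimedeanLocalField.normAbs (w.1.adicCompletion L)
          (Matrix.charpoly (X : Matrix (Fin 3) (Fin 3) (w.1.adicCompletion L))).discr)) : ℝ≥0∞))⁻¹ ∂μ₀ < ∞)
    [MeasurableSpace ↥(unitaryGroupOfForm (galAdicCompletionMap (L := L) (IsCMField.complexConj L) hw) (placeForm (Rogawski1990.qsForm L) w.1))]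
    [BorelSpace ↥(unitaryGroupOfForm (galAdicCompletionMap (L := L) (IsCMField.complexConj L) hw) (placeForm (Rogawski1990.qsForm L) w.1))]
    (ν' : Measure ↥(unitaryGroupOfForm (galAdicCompletionMap (L := L) (IsCMField.complexConj L) hw) (placeForm (Rogawski1990.qsForm L) w.1))) [ν'.IsHaarMeasure]
    (g₀ : ↥(unitaryGroupOfForm (galAdicCompletionMap (L := L) (IsCMField.complexConj L) hw) (placeForm (Rogawski1990.qsForm L) w.1))) :
    ∃ U ∈ 𝓝 g₀, ∫⁻ g in U,
      ((NNReal.sqrt (NNReal.sqrt (IsNonarchimedeanLocalField.normAbs (w.1.adicCompletion L)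
          (((g : ↥(unitaryGroupOfForm (galAdicCompletionMap (L := L) (IsCMField.complexConj L) hw) (placeForm (Rogawski1990.qsForm L) w.1))) :
              GL (Fin 3) (w.1.adicCompletion L)) : Matrix (Fin 3) (Fin 3) (w.1.adicCompletion L)).charpoly.discr *
        ((IsNonarchimedeanLocalField.normAbs (w.1.adicCompletion L)
          (((g : ↥(unitaryGroupOfForm (galAdicCompletionMap (L := L) (IsCMField.complexConj L) hw) (placeForm (Rogawski1990.qsForm L) w.1))) :
              GL (Fin 3) (w.1.adicCompletion L)) : Matrix (Fin 3) (Fin 3) (w.1.adicCompletion L)).det) ^ 2)⁻¹)) : ℝ≥0) : ℝ≥0∞)⁻¹ ∂ν' < ∞ :=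
  exists_nhds_setLIntegral_theta_lt_top_model L v w hw hsq (hss_model L v w hw) ν' g₀

/-! ## §5 ED. 3 — the (iii) leaf DISCHARGED (★ A-p12 `…HCDSlodowySliceFinal`): `hcd_model`, HYPOTHESIS-FREE -/

/-- **The (iii) leaf `hsq` at the model, for EVERY presentation of the trace-zero carrier and EVERY Haar measure on it** (★ A-p12
`exists_nhds_setLIntegral_etaInv_lt_top_of_sq_zero` at `J_w = !![0,0,1;0,1,0;1,0,0]`, with its `hreg` from ★ D5(i) `exists_nhds_setLIntegral_etaIota_lt_top` ∘ ★ (HC) and its `hss`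
from §4 `hss_model`). [cite: HarishChandra1970, Part VII §1 Thm. 15; Part V §4 Lemma 22] [cite: Slodowy1980, §7.4] -/
theorem hsq_model : ∀ (𝔲₀ : AddSubgroup (Matrix (Fin 3) (Fin 3) (w.1.adicCompletion L)))
      (_ : ∀ X, X ∈ 𝔲₀ ↔ (X.map (galAdicCompletionMap (L := L) (IsCMField.complexConj L) hw))ᵀ * placeForm (Rogawski1990.qsForm L) w.1 +
        placeForm (Rogawski1990.qsForm L) w.1 * X = 0 ∧ Matrix.trace X = 0)
      [MeasurableSpace ↥𝔲₀] [BorelSpace ↥𝔲₀] (μ₀ : Measure ↥𝔲₀) [μ₀.IsAddHaarMeasure],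
      ∀ X₀ : ↥𝔲₀, X₀ ≠ 0 → (X₀ : Matrix (Fin 3) (Fin 3) (w.1.adicCompletion L)) * (X₀ : Matrix (Fin 3) (Fin 3) (w.1.adicCompletion L)) = 0 →
        ∃ U ∈ 𝓝 X₀, ∫⁻ X in U, ((NNReal.sqrt (NNReal.sqrt (IsNonarchimedeanLocalField.normAbs (w.1.adicCompletion L)
          (Matrix.charpoly (X : Matrix (Fin 3) (Fin 3) (w.1.adicCompletion L))).discr)) : ℝ≥0∞))⁻¹ ∂μ₀ < ∞ := by
  classical
  intro 𝔲₀ h𝔲₀ _ _ μ₀ _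
  obtain ⟨hσσ, -, hσc, -⟩ := model_pins L v w hw
  have hι := isClosedEmbedding_algebraMap_adicCompletion_place (IsCMField.complexConj L) (IsCMField.complexConj_ne_one L) v w hw
  have hιr : ∀ x : w.1.adicCompletion L, galAdicCompletionMap (L := L) (IsCMField.complexConj L) hw x = x ↔
      x ∈ Set.range (algebraMap (v.adicCompletion ↥(maximalRealSubfield L)) (w.1.adicCompletion L)) :=
    fun x => galAdicCompletionMap_eq_self_iff_mem_range (IsCMField.complexConj L) (IsCMField.complexConj_ne_one L) v w hw x
  obtain ⟨lam, hlam⟩ := exists_units_galAdicCompletionMap_eq_neg (IsCMField.complexConj L) (IsCMField.complexConj_ne_one L) v w hw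
  have hJσ := map_transpose_placeForm_qsForm L v w hw
  have hJd := isUnit_det_placeForm_qsForm L v w
  have hJ' := placeForm_qsForm_eq L v w
  haveI : CharZero (w.1.adicCompletion L) := charZero_of_injective_algebraMap (algebraMap (L : Type) (w.1.adicCompletion L)).injective
  have h2 : (2 : w.1.adicCompletion L) ≠ 0 := two_ne_zero
  have h3 : (3 : w.1.adicCompletion L) ≠ 0 := three_ne_zero
  letI : Invertible (2 : w.1.adicCompletion L) := invertibleOfNonzero h2
  haveI : T2Space (w.1.adicCompletion L) := (IsNonarchimedeanLocalField.isLocalField (w.1.adicCompletion L)).toT2Space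
  -- the cusp carrier `A` with Borel σ-algebra and `addHaar`; closedness of `𝔲₀` and `A`
  obtain ⟨A, hA⟩ := exists_coeffCarrier (galAdicCompletionMap (L := L) (IsCMField.complexConj L) hw)
  letI : MeasurableSpace ↥A := borel _
  haveI : BorelSpace ↥A := ⟨rfl⟩
  have h𝔲₀c := isClosed_traceZero hσc (placeForm (Rogawski1990.qsForm L) w.1) 𝔲₀ h𝔲₀
  have hAc := isClosed_coeffGroup hσc A hA
  haveI : LocallyCompactSpace ↥A := hAc.isClosedEmbedding_subtypeVal.locallyCompactSpace
  -- (i) regular points: ★ D5(i) ∘ ★ (HC)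
  have hreg := fun (X₀ : ↥𝔲₀) hli => exists_nhds_setLIntegral_etaIota_lt_top (galAdicCompletionMap (L := L) (IsCMField.complexConj L) hw) hσσ hJσ hJd h2 lam hlam 𝔲₀ h𝔲₀ h𝔲₀c μ₀ A hA hAc
    (addHaar : Measure ↥A)
    (forall_exists_nhds_setLIntegral_cuspInv_lt_top (galAdicCompletionMap (L := L) (IsCMField.complexConj L) hw) hσσ h2 h3
      (algebraMap (v.adicCompletion ↥(maximalRealSubfield L)) (w.1.adicCompletion L)) hι hιr lam hlam A hA (addHaar : Measure ↥A)) X₀ hli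
  exact exists_nhds_setLIntegral_etaInv_lt_top_of_sq_zero (galAdicCompletionMap (L := L) (IsCMField.complexConj L) hw) hσσ hσc h3
    (algebraMap (v.adicCompletion ↥(maximalRealSubfield L)) (w.1.adicCompletion L)) hι hιr lam hlam hJ' 𝔲₀ h𝔲₀ μ₀ hreg (hss_model L v w hw 𝔲₀ h𝔲₀ μ₀)

set_option maxHeartbeats 1600000 in
-- as §3
/-- **(MI) `hcd_model` — `|D_G|^{−1∕2}` IS LOCALLY `∫⁻`-FINITE ON THE MODEL `U(σ_w, Φ₃)(L_w)`, NO HYPOTHESIS.**  For every Haar measure `ν′` on `U′` and every `g₀ ∈ U′` there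
is `U ∈ 𝓝 g₀` with `∫⁻_U (↑√√(|discr χ_g|_w · |det g|_w⁻²))⁻¹ dν′ < ∞` — the MODEL binder of ★ p852121 `locallyIntegrable_weylDiscr_inv_of_forall_model` VERBATIM, hence RUNG0's
`hDGliO` by D7-FINAL: `locallyIntegrable_weylDiscr_inv_of_forall_model (fun L _ _ _ v w hw _ _ ν′ _ => hcd_model L v w hw ν′) L v hns νQv`.  Road «HC-D» closes here on the
model: §3 (★ F-D6 §4 ∘ ★ GLOBAL-FINAL ∘ (MP)(HC)(NB)(CO)) with §4 `hss_model` (★ D5(ii)) and §5 `hsq_model` (★ D5(iii)). [cite: HarishChandra1970, Part VII §1 Thm. 15]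
[cite: Rogawski1990, §4.9 p. 54; §12.5 p. 182] [cite: PlatonovRapinchuk1994, §3.3; §5.1] -/
theorem hcd_model
    [MeasurableSpace ↥(unitaryGroupOfForm (galAdicCompletionMap (L := L) (IsCMField.complexConj L) hw) (placeForm (Rogawski1990.qsForm L) w.1))]
    [BorelSpace ↥(unitaryGroupOfForm (galAdicCompletionMap (L := L) (IsCMField.complexConj L) hw) (placeForm (Rogawski1990.qsForm L) w.1))]
    (ν' : Measure ↥(unitaryGroupOfForm (galAdicCompletionMap (L := L) (IsCMField.complexConj L) hw) (placeForm (Rogawski1990.qsForm L) w.1))) [ν'.IsHaarMeasure]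
    (g₀ : ↥(unitaryGroupOfForm (galAdicCompletionMap (L := L) (IsCMField.complexConj L) hw) (placeForm (Rogawski1990.qsForm L) w.1))) :
    ∃ U ∈ 𝓝 g₀, ∫⁻ g in U,
      ((NNReal.sqrt (NNReal.sqrt (IsNonarchimedeanLocalField.normAbs (w.1.adicCompletion L)
          (((g : ↥(unitaryGroupOfForm (galAdicCompletionMap (L := L) (IsCMField.complexConj L) hw) (placeForm (Rogawski1990.qsForm L) w.1))) :
              GL (Fin 3) (w.1.adicCompletion L)) : Matrix (Fin 3) (Fin 3) (w.1.adicCompletion L)).charpoly.discr *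
        ((IsNonarchimedeanLocalField.normAbs (w.1.adicCompletion L)
          (((g : ↥(unitaryGroupOfForm (galAdicCompletionMap (L := L) (IsCMField.complexConj L) hw) (placeForm (Rogawski1990.qsForm L) w.1))) :
              GL (Fin 3) (w.1.adicCompletion L)) : Matrix (Fin 3) (Fin 3) (w.1.adicCompletion L)).det) ^ 2)⁻¹)) : ℝ≥0) : ℝ≥0∞)⁻¹ ∂ν' < ∞ :=
  exists_nhds_setLIntegral_theta_lt_top_model₂ L v w hw (hsq_model L v w hw) ν' g₀

end CM

end Summit.HodgeConjecture.HodgeConjecture.Cruxes.H413.F0P3cStCharTSHCDModel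

end
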